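import Literature.MathematicalPhysics.QuantumFieldTheory.Balaban1983to89.B6Prop26KLevelAssemblyV1
import Literature.MathematicalPhysics.QuantumFieldTheory.Balaban1983to89.B6Prop26LeftEntryKLevelV1

/-!
# `Balaban1983to89.B6Prop26PairKLevelAssemblyV1` — T. Bałaban, *Propagators and renormalization transformations for lattice gauge theories. II*,
# Commun. Math. Phys. **96** (1984) 223–250 [Balaban1984PropagatorsII], Prop. 2.6 p. 247 for the GENUINE `k`-level `G = Δ_a⁻¹` on the V1 torus —
# THE ASSEMBLY RUN ON THE «PAIR» SKELETON: (2.136)₁ AND the universal LEFT-FACTOR clause (the entries `|(∇GJ)(x)|`, `|(ΔGJ)(x)|` of (2.136)) at once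

statement-level skeleton of published theorems with citation tags; proofs where landed; nothing here is a claim about the Yang–Mills mass gap

PDF held: `paper:balaban1984-cmp96-propagators-rt-ii` (journal page = PDF page + 222): p. 247 [PDF 25] ((2.133)–(2.136), (2.141), Prop. 2.6), p. 239 [PDF 17]
((2.89)–(2.94)), p. 238 [PDF 16] ((2.88)); re-read this generation on the text layer (`p0025.txt`, `p0017.txt`) and from the tree transcriptions in the
imported modules.

CITATION HEADER (lean-in-tree rule) — WHAT IS REPRODUCED.  Phase-2 file of the `lit-balaban` typed skeleton (HOME `run/shared/lean/pub/lit-balaban/`), seat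
**p38 gen 30** (free target under protocol G.5-34(d), TAKING line HOME/STATUS.md 2026-08-23T13:2xZ, cc the B6 fold owner r03 and the consumer r05);
SKELETON rows **B6.Prop2.6** × B6.Eq2.134 × B6.Eq2.133 × B6.Eq2.91 × B6.Eq2.88 × B6.Eq2.36 × B6.Lem2.1 (cells; decls of record untouched).
THE PROOF SCRIPT IS r03's `…B6Prop26KLevelAssemblyV1.prop26_2136_kLevel_assembly_le` (r03 gen 21, v1.4) VERBATIM — same binders in the same order, same
constants (`σ₀ = ρ/2`, `A = 2·(Nbig·C_G)·K261…`, `M₁`), same discharge of every skeleton hypothesis by the same tree theorems (p38's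
`inputs2134_kFam_torus_in`, r03's `hGin_cube`/`hEGin_cube`/`hNin_cube`/`hNout_cube`/`hPlin_cube`/`hPlout_cube`, p22's `hasMajorant_Dg_V1_TB`, the partition
binders, `hagree_cube`/`hinvl_cube`) — with ONE change: the two-family skeleton it feeds is p38's `…B6Prop26LeftEntryKLevelV1.prop26_pair_kLevel_skeleton₂'`
(whose hypotheses are those of r03's `prop26_2136_kLevel_skeleton₂'` verbatim), so that the conclusion is the PAIR:
* slot 1 — r03's (2.136)₁ majorant `A·(L^{j(y)}/c′)²·e^{−delta3 α (2σ)·d_T}` of `onFun G` (literally `prop26_2136_kLevel_assembly_le`'s conclusion), AND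
* the LEFT-FACTOR CLAUSE — for every left factor `D`, constant `A′ ≥ 0` and weight `P′ ≥ 0`: if every cube's first leg `D·(h_□G_□h_□)` has the majorant
  `1_{□̃}(y)·A′P′(y)·e^{−σ d_T}`, then `D·(onFun G)` has the majorant `2(Nbig·A′)·K261(N₀, d+1, L, 1, ασ)·P′(y)·e^{−delta3 α (2σ)·d_T}` — print's
  *"reasoning in the same way as in the proof of Proposition 2.2"* for the columns `Lʲη` / `1` of the table in (2.136): the SAME walk (2.141) with the
  SAME (2.134)/(2.135) majorant of `R` (derived ONCE here), only the first leg changed.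
WHY A COPY OF THE SCRIPT AND NOT A CALL: the (2.134)/(2.135) majorant of `R = Σ K_{□,□′}G_{□′}h_{□′}` and its smallness live INSIDE r03's proof (they are not
a theorem of the tree); the left-factor entries need exactly that majorant (`DG = DG₀ + (DG)R`).  Running the script once on the pair skeleton makes every
left-factor entry of (2.136) available WITHOUT further copies (this seat: `∇_ν`, file `B6Prop26GradKLevelV1`; later `Δ`).
IMPORTS BY NAME, restating nothing; THEOREM ONLY (no `def`, no `def … : Prop`, no new hypothesis); standard axioms.

HONEST SCOPE / DIVERGENCES.  As `prop26_2136_kLevel_assembly_le`: (1) the `□̃`-overlap count, `OutLoc (M_□h_□) □̃`, the line-1 coefficient sizes/supports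
and the line-3 majorant at rate `2σ` stay DISPLAYED (their producers are in the tree / r03 g22's line-3 lane; the `_line3`-style discharge is done in the
consumer file `B6Prop26GradKLevelV1`); (2) `L ≥ 5`, `M_h = Lᵃ ≥ 8`, `R ≥ 2L²`, `P′_μ ≥ 5`, `k ≥ 2`, cubes placed, thresholds `M₁ ≤ L·M_h`,
`N₀ + 1 ≤ R·L·M_h`, the (2.59)-shape budget at rate `σ`; (3) constants on `d, L, b₀, b₁` (+ `α, N₀, Nbig, s₁, s₂, C_D, c_D` for `A, M₁`), uniform in
`k, M_h, m, K, c′`; the clause's constant is explicit.  (4) The per-cube left-factor legs are NOT discharged here (they are the clause's hypothesis).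
Integer torus, lattice units; nothing on d = 4 specifically or the continuum; NOT summit progress.  Unit `lit-balaban-p38` (gen 30), 2026-08-23.
-/

open scoped BigOperators
open Finset

namespace Literature.MathematicalPhysics.QuantumFieldTheory.Balaban1983to89.B6Prop26PairKLevelAssemblyV1

open B4Reflection242 (boxDom)
open B6MultiLevelBoxOperator (N0)
open B6MultiLevelTorusOperator (TDomains)
open B6Cover236MultiLevelBlocks (cubes)
open B6Geom246MultiLevelBox (bset blkOf)
open B6Geom246MultiLevelTorus (geomT bondT)
open B8Ineq192MultiLevelTorus (geomTB geomTB_len geomTB_M geomTB_dist)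
open B6RandomWalk (HasMajorant hasMajorant_mono delta3 BlockSupp)
open B6Prop26Gluing (mulOp mulOp_apply LocalMajorant OutLoc)
open B6Prop26ReachTransplant (localMajorant_smul_of_le)
open B6Ineq261LevelGap (K261 K261_nonneg)
open B6Eq291Generator (kFam)
open B6Ineq2133TwoScaleV1 (onFun)
open B6GlobalChartV1 (PV toBox domT blkV1)
open B6SectAOperatorsV1 (dE dsE dcE dcsE QE aE QsE RE BondIdx)
open B6SectAVectorModelV1 (GE)
open B6Partition118KLevelTorus (hT)
open B6Partition118KLevelTorusCentral (QT QbigT zetaT zetaT_nonneg zetaT_le_one not_mem_QbigT_of_zetaT_ne_one one_le_of_four_le)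
open B6Partition118KLevelTorusBinders (sLipT sLipT_nonneg abs_hT_sub_le_distT gap_QT)
open B6Prop26KLevelSkeletonV1 (hB zB ST mem_ST pref pref_nonneg abs_hB_le_one blkV1_mem_QT_of_hB_ne_zero)
open B6Prop26KLevelSkeletonV2 (SbigT mem_SbigT hNov_SbigT_of_QbigT kFam_smul prop26_2136_kLevel_skeleton₂')
open B6InMajorantTransplant (InMajorant inMajorant_mono inMajorant_smul InMajorant.localMajorant)
open B6InDecayWindowV1 (OutMajorant outMajorant_mono outMajorant_smul)
open B6CubeWindowV1 (Placed Gl Ml Pl GlobalBand hagree_cube hinvl_cube band_of_global band_le one_le_of_eight_le four_le_of_five_le)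
open B6CubeInDecayV1 (hGin_cube hEGin_cube hNin_cube hNout_cube hPlin_cube hPlout_cube)
open B6Eq292MemberTorusV1 (EC cfC c0C NC zC hdec_cube abs_zC_le)
open B6Ineq2134KFamKLevelTorusIn (inputs2134_kFam_torus_in)
open B6Dg288ChartV1 (hasMajorant_Dg_V1_TB)

open B6Prop26LeftEntryKLevelV1 (prop26_pair_kLevel_skeleton₂')
open B6Prop26Gluing (ind)
open B6Prop26KLevelAssemblyV1 (hasMajorant_smul mulOp_const_mul hdec_smul small_of_small_two final_const_le sq_mul_pref inv_sq_mul_pref_inv lenTB_pos distT_nonneg hasMajorant_TB hasMajorant_T_of_TB inMajorant_TB localMajorant_TB outMajorant_TB)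

noncomputable section

variable {d ℓ : ℕ} {hd : 1 ≤ d + 1} {hL : Odd (ℓ + 1) ∧ 1 < ℓ + 1} {m K : ℕ} {Mh k R : ℕ} {P' : Fin (d + 1) → ℕ}

/-! ## §1  The pair assembly (r03's `prop26_2136_kLevel_assembly_le` script on the pair skeleton) -/

section Assembly

/-- monotonicity of the exponential in the rate. [folklore] -/
private theorem exp_le_exp_of_rate {ρ σ t : ℝ} (h : σ ≤ ρ) (ht : 0 ≤ t) : Real.exp (-(ρ * t)) ≤ Real.exp (-(σ * t)) :=
  Real.exp_le_exp.mpr (neg_le_neg (mul_le_mul_of_nonneg_right h ht))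

set_option maxHeartbeats 400000 in -- one copy of r03's (2.136)₁ assembly script PLUS the left-factor clause: ≈ 1.2× the default budget
open Classical in
/-- **PROPOSITION 2.6 FOR THE GENUINE k-LEVEL `G` — THE PAIR ASSEMBLY WITH THE RATE AS A PARAMETER**: r03's `prop26_2136_kLevel_assembly_le` (same
binders, same displayed inputs (i)–(iv), same constants) with the conclusion strengthened to (2.136)₁ ∧ the universal left-factor clause at rate `σ`.
[cite: Balaban1984PropagatorsII, Prop. 2.6 (2.136) p.247, (2.141) p.247, (2.133)–(2.135) p.247, (2.88)–(2.94) pp.238–239, (2.36) p.229, Lemma 2.1 p.234] -/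
theorem prop26_pair_kLevel_assembly_le (d ℓ : ℕ) (hd : 1 ≤ d + 1) (hL : Odd (ℓ + 1) ∧ 1 < ℓ + 1) {b₀ b₁ : ℝ} (hb₀ : 0 < b₀) (hb₁ : b₀ ≤ b₁) :
    ∃ σ₀ : ℝ, 0 < σ₀ ∧ ∀ (σ : ℝ), 0 < σ → σ ≤ σ₀ → ∀ (α : ℝ), 0 ≤ α → α ≤ 1 → ∀ (N₀ : ℕ), 0 < N₀ → ∀ (Nbig : ℕ) {s₁ s₂ CD cD : ℝ}, 0 ≤ s₁ → 0 ≤ s₂ → 0 ≤ CD → 0 < cD →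
    ∃ A M₁ : ℝ, 0 ≤ A ∧ 0 < M₁ ∧
    ∀ (m K : ℕ) {Mh k R : ℕ} {P' : Fin (d + 1) → ℕ}
      (hN : ∀ μ, N0 ℓ Mh k P' μ = (PV d ℓ m K hd hL).sitesPerDir 0) (D : TDomains d ℓ Mh k P' R) (hk : k ≤ m + K) (_ : 2 ≤ k)
      {a : ℕ} (hMha : Mh = (ℓ + 1) ^ a) (hM8 : 8 ≤ Mh) (_ : 2 * (ℓ + 1) ^ 2 ≤ R) (hP5 : ∀ μ, 5 ≤ P' μ) (_ : 4 ≤ ℓ)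
      (hpl : ∀ c : ↥(cubes D.toDomains), Placed ℓ k P' c.1)
      (_ : M₁ ≤ ((ℓ : ℝ) + 1) * Mh) (_ : N₀ + 1 ≤ R * ((ℓ + 1) * Mh))
      (_ : Real.exp (-(α * σ)) * ((ℓ : ℝ) + 1) ^ ((2 * (d + 1 : ℕ) : ℝ) / N₀) < 1)
      {cf : ℝ} (hcf : cf ≠ 0) {w : BondIdx (domT hN D hk) → ℝ} (hw : ∀ i, 0 < w i) (_ : GlobalBand b₀ b₁ cf w)
      -- the overlap count of the `□̃` (p21)
      (_ : ∀ y : (geomT D).Site, (Finset.univ.filter fun c : ↥(cubes D.toDomains) =>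
        y ∈ QbigT D (one_le_of_eight_le hM8) (four_le_of_five_le hP5) c).card ≤ Nbig)
      -- the output localisation of `M_□h_□` (p38)
      (_ : ∀ c : ↥(cubes D.toDomains), OutLoc (g := geomT D) (blkV1 hN D)
        (Ml hN hk (one_le_of_eight_le hM8) (four_le_of_five_le hP5) hMha c (band_le (d := d) (ℓ := ℓ) hb₀ hb₁) (hpl c) w cf * mulOp (hB hN D c))
        (SbigT D (one_le_of_eight_le hM8) (four_le_of_five_le hP5) c))
      -- the line-1 coefficients: sizes and supports (p38)
      (_ : ∀ (c : ↥(cubes D.toDomains)) (e : Fin (d + 1) × Bool) (x : PBond (PV d ℓ m K hd hL) 0),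
        |cfC hN hk (one_le_of_eight_le hM8) (four_le_of_five_le hP5) hMha c (band_le (d := d) (ℓ := ℓ) hb₀ hb₁) (hpl c) w cf e x| ≤
          s₁ * cf ^ 2 / ((geomTB D).M * (geomTB D).len (blkV1 hN D x) ^ 2))
      (_ : ∀ (c : ↥(cubes D.toDomains)) (e : Fin (d + 1) × Bool) (x : PBond (PV d ℓ m K hd hL) 0),
        cfC hN hk (one_le_of_eight_le hM8) (four_le_of_five_le hP5) hMha c (band_le (d := d) (ℓ := ℓ) hb₀ hb₁) (hpl c) w cf e x ≠ 0 →
          blkV1 hN D x ∈ ST D (one_le_of_eight_le hM8) (four_le_of_five_le hP5) c)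
      (_ : ∀ (c : ↥(cubes D.toDomains)) (x : PBond (PV d ℓ m K hd hL) 0),
        |c0C hN hk (one_le_of_eight_le hM8) (four_le_of_five_le hP5) hMha c (band_le (d := d) (ℓ := ℓ) hb₀ hb₁) (hpl c) w cf x| ≤
          s₂ * cf ^ 2 / ((geomTB D).M * (geomTB D).len (blkV1 hN D x) ^ 2))
      (_ : ∀ (c : ↥(cubes D.toDomains)) (x : PBond (PV d ℓ m K hd hL) 0),
        c0C hN hk (one_le_of_eight_le hM8) (four_le_of_five_le hP5) hMha c (band_le (d := d) (ℓ := ℓ) hb₀ hb₁) (hpl c) w cf x ≠ 0 →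
          blkV1 hN D x ∈ ST D (one_le_of_eight_le hM8) (four_le_of_five_le hP5) c)
      -- line 3 (p38/p22)
      (_ : ∀ c : ↥(cubes D.toDomains), HasMajorant (g := geomTB D) (blkV1 hN D)
        (mulOp (zB hN D (one_le_of_eight_le hM8) (four_le_of_five_le hP5) c) *
          (onFun (dE (P := PV d ℓ m K hd hL) cf ∘ₗ (LinearMap.id - RE (domT hN D hk) cf) ∘ₗ dsE cf) -
            Pl hN hk (one_le_of_eight_le hM8) (four_le_of_five_le hP5) hMha c (band_le (d := d) (ℓ := ℓ) hb₀ hb₁) (hpl c) w cf) *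
          mulOp (hB hN D c))
        (fun y y'' => CD * cf ^ 2 * Real.exp (-(cD * (geomTB D).M)) / (geomTB D).len y ^ 2 * Real.exp (-((2 * σ) * (geomTB D).dist y y'')))),
      HasMajorant (g := geomT D) (blkV1 hN D) (onFun (GE (domT hN D hk) hcf hw))
        (fun y y' => A * pref cf y * Real.exp (-(delta3 α (2 * σ) * (geomT D).dist y y'))) ∧
      ∀ (Dop : Module.End ℝ (PBond (PV d ℓ m K hd hL) 0 → ℝ)) (A' : ℝ) (Pw : (geomT D).Site → ℝ), 0 ≤ A' → (∀ y, 0 ≤ Pw y) →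
        (∀ c : ↥(cubes D.toDomains), HasMajorant (g := geomT D) (blkV1 hN D)
          (Dop * (mulOp (hB hN D c) *
            Gl hN hk (one_le_of_eight_le hM8) (four_le_of_five_le hP5) hMha c (band_le (d := d) (ℓ := ℓ) hb₀ hb₁) (hpl c) w cf *
            mulOp (hB hN D c)))
          (fun y y' => ind (SbigT D (one_le_of_eight_le hM8) (four_le_of_five_le hP5) c) y *
            (A' * Pw y * Real.exp (-(σ * (geomT D).dist y y'))))) →
        HasMajorant (g := geomT D) (blkV1 hN D) (Dop * onFun (GE (domT hN D hk) hcf hw))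
          (fun y y' => 2 * ((Nbig : ℝ) * A') * K261 N₀ (d + 1) ((ℓ : ℝ) + 1) 1 (α * σ) * Pw y *
            Real.exp (-(delta3 α (2 * σ) * (geomT D).dist y y'))) := by
  -- ### constants of the member / global inputs (all on `d, L, b₀, b₁` only)
  have ha₀ : (0 : ℝ) < b₀ / ((ℓ + 1 : ℕ) : ℝ) := by positivity
  obtain ⟨ρG, hρG, CG, hCG, hGin⟩ := hGin_cube d ℓ hd hL ha₀ (band_le (d := d) (ℓ := ℓ) hb₀ hb₁)
  obtain ⟨ρE, hρE, CE, hCE, hEGin⟩ := hEGin_cube d ℓ hd hL ha₀ (band_le (d := d) (ℓ := ℓ) hb₀ hb₁)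
  obtain ⟨ρN, hρN, CN, hCN, hNin⟩ := hNin_cube d ℓ hd hL ha₀ (band_le (d := d) (ℓ := ℓ) hb₀ hb₁)
  obtain ⟨ρN', hρN', CN', hCN', hNout⟩ := hNout_cube d ℓ hd hL ha₀ (band_le (d := d) (ℓ := ℓ) hb₀ hb₁)
  obtain ⟨ρP, hρP, CP, hCP, hPlin⟩ := hPlin_cube d ℓ hd hL ha₀ (band_le (d := d) (ℓ := ℓ) hb₀ hb₁)
  obtain ⟨ρP', hρP', CP', hCP', hPlout⟩ := hPlout_cube d ℓ hd hL ha₀ (band_le (d := d) (ℓ := ℓ) hb₀ hb₁)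
  obtain ⟨M₃, δ₂, C₂, hM₃, hδ₂, hC₂, hDg⟩ := hasMajorant_Dg_V1_TB d ℓ hd hL
  -- the common rate `ρ = 2σ` of the (2.134) inputs
  obtain ⟨ρ, hρ, hρG', hρE', hρN1, hρN2, hρP1, hρP2, hρD⟩ : ∃ ρ : ℝ, 0 < ρ ∧ ρ ≤ ρG ∧ ρ ≤ ρE ∧ ρ ≤ ρN ∧ ρ ≤ ρN' ∧ ρ ≤ ρP ∧ ρ ≤ ρP' ∧ ρ ≤ δ₂ := by
    refine ⟨min ρG (min ρE (min ρN (min ρN' (min ρP (min ρP' δ₂))))),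
      lt_min hρG (lt_min hρE (lt_min hρN (lt_min hρN' (lt_min hρP (lt_min hρP' hδ₂))))), min_le_left _ _, ?_, ?_, ?_, ?_, ?_, ?_⟩
    · exact (min_le_right _ _).trans (min_le_left _ _)
    · exact (min_le_right _ _).trans ((min_le_right _ _).trans (min_le_left _ _))
    · exact (min_le_right _ _).trans ((min_le_right _ _).trans ((min_le_right _ _).trans (min_le_left _ _)))
    · exact (min_le_right _ _).trans ((min_le_right _ _).trans ((min_le_right _ _).trans ((min_le_right _ _).trans (min_le_left _ _))))
    · exact (min_le_right _ _).trans ((min_le_right _ _).trans ((min_le_right _ _).trans ((min_le_right _ _).trans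
        ((min_le_right _ _).trans (min_le_left _ _)))))
    · exact (min_le_right _ _).trans ((min_le_right _ _).trans ((min_le_right _ _).trans ((min_le_right _ _).trans
        ((min_le_right _ _).trans (min_le_right _ _)))))
  refine ⟨ρ / 2, by positivity, ?_⟩
  intro σ hσ0 hσle α hα0 hα1 N₀ hN₀ Nbig s₁ s₂ CD cD hs₁ hs₂ hCD hcD
  have h2σ : 2 * σ ≤ ρ := by linarith
  have h2σ0 : 0 < 2 * σ := by positivity
  -- one constant for the four `N`/`P` majorants
  obtain ⟨CNN, hCNN0, hCN1, hCN2, hCP1, hCP2⟩ : ∃ CNN : ℝ, 0 ≤ CNN ∧ CN ≤ CNN ∧ CN' ≤ CNN ∧ CP ≤ CNN ∧ CP' ≤ CNN :=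
    ⟨max (max CN CN') (max CP CP'), le_max_of_le_left (le_max_of_le_left hCN), le_max_of_le_left (le_max_left _ _),
      le_max_of_le_left (le_max_right _ _), le_max_of_le_right (le_max_left _ _), le_max_of_le_right (le_max_right _ _)⟩
  have hK0 : 0 ≤ K261 N₀ (d + 1) ((ℓ : ℝ) + 1) 1 (α * σ) := K261_nonneg (by positivity) zero_le_one
  -- p38's threshold for the RESCALED family (all constants `c′`-free)
  obtain ⟨M₁, Θ, hM₁, hΘ, h38⟩ := inputs2134_kFam_torus_in d ℓ (δG := 2 * σ) (CP := ((d : ℝ) + 1) * C₂) (CG := CG) (C₁ := CE) (CN := CNN)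
    (CD := CD) (cD := cD) (s := sLipT d ℓ) (s₁ := s₁) (s₂ := s₂) (r₀ := 1) (m := 1 / (2 * ((ℓ : ℝ) + 1) ^ 2))
    (c₁ := 2 * K261 N₀ (d + 1) ((ℓ : ℝ) + 1) 1 (α * σ)) (Fintype.card (Fin (d + 1) × Bool)) 1 Nbig h2σ0 (by positivity) hCG hCE hCNN0 hCD
    hcD (sLipT_nonneg d ℓ) hs₁ hs₂ zero_le_one (by positivity) (by positivity)
  refine ⟨2 * ((Nbig : ℝ) * CG) * K261 N₀ (d + 1) ((ℓ : ℝ) + 1) 1 (α * σ), max M₁ M₃, by positivity, lt_max_of_lt_left hM₁, ?_⟩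
  intro m K Mh k R P' hN D hk hk2 a hMha hM8 hR2 hP5 hℓ hpl hM₁' hRM hθ cf hcf w hw hwb hNbig hMout hcfA hcfT hc0A hc0T hD3
  -- ### the torus
  have hMh1 : 1 ≤ Mh := one_le_of_eight_le hM8
  have hP4 : ∀ μ, 4 ≤ P' μ := four_le_of_five_le hP5
  have hP : ∀ μ, 1 ≤ P' μ := one_le_of_four_le hP4
  have hMh : 2 ≤ Mh := le_trans (by norm_num) hM8
  have hR : 2 * (ℓ + 1) ≤ R := le_trans (by nlinarith : 2 * (ℓ + 1) ≤ 2 * (ℓ + 1) ^ 2) hR2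
  have hℓ1 : 1 ≤ ℓ := le_trans (by norm_num) hℓ
  have hLM : M₁ ≤ ((ℓ : ℝ) + 1) * Mh := le_trans (le_max_left _ _) hM₁'
  have hLM₃ : M₃ ≤ ((ℓ : ℝ) + 1) * Mh := le_trans (le_max_right _ _) hM₁'
  have hcf2 : cf ^ 2 ≠ 0 := pow_ne_zero 2 hcf
  have hcf2pos : 0 < cf ^ 2 := by positivity
  have habs2 : |cf ^ 2| = cf ^ 2 := abs_of_pos hcf2pos
  have habs2i : |(cf ^ 2)⁻¹| = (cf ^ 2)⁻¹ := abs_of_pos (inv_pos.2 hcf2pos)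
  have hMpos : 0 < (geomTB D).M := by rw [geomTB_M]; positivity
  have hdnn : ∀ y y' : (geomT D).Site, 0 ≤ (geomT D).dist y y' := distT_nonneg
  -- ### p38's theorem at this torus: smallness + the (2.134) family bound for the rescaled members
  obtain ⟨hsmall, h2134⟩ := h38 D hMh1 hP hR hLM
  -- the global `∂P∂*` (p22), rescaled by `c′⁻²`
  have hDg' : HasMajorant (g := geomTB D) (blkV1 hN D)
      ((cf ^ 2)⁻¹ • onFun (dE (P := PV d ℓ m K hd hL) cf ∘ₗ (LinearMap.id - RE (domT hN D hk) cf) ∘ₗ dsE cf))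
      (fun y y'' => ((d : ℝ) + 1) * C₂ / (geomTB D).len y ^ 2 * Real.exp (-((2 * σ) * (geomTB D).dist y y''))) := by
    refine hasMajorant_mono _ (hasMajorant_smul _ (hDg m K hN D hk hMh1 hP4 hR hLM₃ hcf) _) fun y y'' => ?_
    rw [habs2i]
    have hl := lenTB_pos (D := D) y
    calc (cf ^ 2)⁻¹ * (cf ^ 2 * ((d : ℝ) + 1) * C₂ / (geomTB D).len y ^ 2 * Real.exp (-(δ₂ * (geomTB D).dist y y'')))
        = ((d : ℝ) + 1) * C₂ / (geomTB D).len y ^ 2 * Real.exp (-(δ₂ * (geomTB D).dist y y'')) := by field_simp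
      _ ≤ ((d : ℝ) + 1) * C₂ / (geomTB D).len y ^ 2 * Real.exp (-((2 * σ) * (geomTB D).dist y y'')) :=
          mul_le_mul_of_nonneg_left (exp_le_exp_of_rate (h2σ.trans hρD) (hdnn y y'')) (by positivity)
  have H := h2134 (blkV1 hN D) hDg' (Finset.univ : Finset ↥(cubes D.toDomains))
    (G := fun c => cf ^ 2 • Gl hN hk hMh1 hP4 hMha c (band_le (d := d) (ℓ := ℓ) hb₀ hb₁) (hpl c) w cf)
    (Ml := fun c => (cf ^ 2)⁻¹ • Ml hN hk hMh1 hP4 hMha c (band_le (d := d) (ℓ := ℓ) hb₀ hb₁) (hpl c) w cf)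
    (Pl := fun c => (cf ^ 2)⁻¹ • Pl hN hk hMh1 hP4 hMha c (band_le (d := d) (ℓ := ℓ) hb₀ hb₁) (hpl c) w cf)
    (h := fun c => hB hN D c) (ζ := fun c => zB hN D hMh1 hP4 c)
    (c₀ := fun c x => (cf ^ 2)⁻¹ * c0C hN hk hMh1 hP4 hMha c (band_le (d := d) (ℓ := ℓ) hb₀ hb₁) (hpl c) w cf x)
    (T := fun c => ST D hMh1 hP4 c) (S := fun c => ST D hMh1 hP4 c) (Score := fun c => SbigT D hMh1 hP4 c)
    (DE := fun _ => (Finset.univ : Finset (Fin (d + 1) × Bool)))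
    (E := fun c e => EC hN hk hMh1 hP4 hMha c (band_le (d := d) (ℓ := ℓ) hb₀ hb₁) (hpl c) w cf e)
    (cf := fun c e x => (cf ^ 2)⁻¹ * cfC hN hk hMh1 hP4 hMha c (band_le (d := d) (ℓ := ℓ) hb₀ hb₁) (hpl c) w cf e x)
    (DK := fun _ => ({()} : Finset Unit))
    (N := fun c _ => (cf ^ 2)⁻¹ • NC hN hk hMh1 hP4 hMha c (band_le (d := d) (ℓ := ℓ) hb₀ hb₁) (hpl c) w cf)
    (z := fun c _ => zC hN hk hMh1 hP4 hMha c (band_le (d := d) (ℓ := ℓ) hb₀ hb₁) (hpl c) w cf)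
    -- hnE, hnK
    (fun c _ => le_of_eq Finset.card_univ) (fun c _ => by simp)
    -- hdec
    (fun c _ => hdec_smul Finset.univ ({()} : Finset Unit)
      (N := fun _ => NC hN hk hMh1 hP4 hMha c (band_le (d := d) (ℓ := ℓ) hb₀ hb₁) (hpl c) w cf)
      (z := fun _ => zC hN hk hMh1 hP4 hMha c (band_le (d := d) (ℓ := ℓ) hb₀ hb₁) (hpl c) w cf)
      (hdec_cube hN hk hMh1 hP4 hMha c (band_le (d := d) (ℓ := ℓ) hb₀ hb₁) hM8 hR2 (hpl c) w cf) _)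
    -- hGin
    (fun c _ => by
      refine inMajorant_TB hN (inMajorant_mono (g := geomT D) _ (inMajorant_smul _ (hGin m K hN D hk hMh1 hP4 hMha hMh hR2 hℓ c (hpl c) w cf) (cf ^ 2))
        (K' := fun (y y' : (geomT D).Site) => CG * (geomTB D).len y ^ 2 * Real.exp (-((2 * σ) * (geomT D).dist y y'))) fun y y' _ => ?_)
      rw [habs2, ← sq_mul_pref cf hcf y]
      have := pref_nonneg cf y
      calc cf ^ 2 * (CG * pref cf y * Real.exp (-(ρG * (geomT D).dist y y')))
          = CG * (cf ^ 2 * pref cf y) * Real.exp (-(ρG * (geomT D).dist y y')) := by ring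
        _ ≤ CG * (cf ^ 2 * pref cf y) * Real.exp (-((2 * σ) * (geomT D).dist y y')) :=
            mul_le_mul_of_nonneg_left (exp_le_exp_of_rate (h2σ.trans hρG') (hdnn y y')) (by positivity))
    -- hEG
    (fun c _ e _ => by
      have hx := inMajorant_mono (g := geomT D) _ (inMajorant_smul _ (hEGin m K hN D hk hMh1 hP4 hMha hMh hR2 hℓ c (hpl c) w cf e) (cf ^ 2))
        (K' := fun (y y' : (geomT D).Site) => CE * (geomTB D).len y ^ 2 * Real.exp (-((2 * σ) * (geomT D).dist y y'))) fun y y' _ => by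
          rw [habs2, ← sq_mul_pref cf hcf y]
          have := pref_nonneg cf y
          calc cf ^ 2 * (CE * pref cf y * Real.exp (-(ρE * (geomT D).dist y y')))
              = CE * (cf ^ 2 * pref cf y) * Real.exp (-(ρE * (geomT D).dist y y')) := by ring
            _ ≤ CE * (cf ^ 2 * pref cf y) * Real.exp (-((2 * σ) * (geomT D).dist y y')) :=
                mul_le_mul_of_nonneg_left (exp_le_exp_of_rate (h2σ.trans hρE') (hdnn y y')) (by positivity)
      rw [← mul_smul_comm] at hx
      exact localMajorant_TB hN hx.localMajorant)
    -- hcf, hcfT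
    (fun c _ e _ x => by
      have hl := lenTB_pos (D := D) (blkV1 hN D x)
      rw [abs_mul, habs2i]
      calc (cf ^ 2)⁻¹ * |cfC hN hk hMh1 hP4 hMha c (band_le (d := d) (ℓ := ℓ) hb₀ hb₁) (hpl c) w cf e x|
          ≤ (cf ^ 2)⁻¹ * (s₁ * cf ^ 2 / ((geomTB D).M * (geomTB D).len (blkV1 hN D x) ^ 2)) :=
            mul_le_mul_of_nonneg_left (hcfA c e x) (by positivity)
        _ = s₁ / ((geomTB D).M * (geomTB D).len (blkV1 hN D x) ^ 2) := by field_simp)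
    (fun c _ e _ x hx => hcfT c e x (right_ne_zero_of_mul hx))
    -- hc₀, hc₀T
    (fun c _ x => by
      have hl := lenTB_pos (D := D) (blkV1 hN D x)
      rw [abs_mul, habs2i]
      calc (cf ^ 2)⁻¹ * |c0C hN hk hMh1 hP4 hMha c (band_le (d := d) (ℓ := ℓ) hb₀ hb₁) (hpl c) w cf x|
          ≤ (cf ^ 2)⁻¹ * (s₂ * cf ^ 2 / ((geomTB D).M * (geomTB D).len (blkV1 hN D x) ^ 2)) :=
            mul_le_mul_of_nonneg_left (hc0A c x) (by positivity)
        _ = s₂ / ((geomTB D).M * (geomTB D).len (blkV1 hN D x) ^ 2) := by field_simp)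
    (fun c _ x hx => hc0T c x (right_ne_zero_of_mul hx))
    -- hh1, hhS, hST, hLip
    (fun c _ x => abs_hB_le_one hN D hMh1 hP c x)
    (fun c _ x hx => blkV1_mem_QT_of_hB_ne_zero hN D hMh hR hP4 c hx)
    (fun c _ => fun _ hy => hy)
    (fun c _ x x' => abs_hT_sub_le_distT hℓ1 hMh hR hP5 c (toBox hN x.src) (toBox hN x'.src))
    -- hNin, hNout
    (fun c _ k _ => by
      refine inMajorant_TB hN (inMajorant_mono (g := geomT D) _ (inMajorant_smul _ (hNin m K hN D hk hMh1 hP4 hMha hMh hR2 hℓ c (hpl c) w cf) ((cf ^ 2)⁻¹))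
        (K' := fun (y y'' : (geomT D).Site) => CNN / (geomTB D).len y ^ 2 * Real.exp (-((2 * σ) * (geomT D).dist y y''))) fun y y'' _ => ?_)
      rw [habs2i]
      have hl := lenTB_pos (D := D) y
      calc (cf ^ 2)⁻¹ * (CN * (pref cf y)⁻¹ * Real.exp (-(ρN * (geomT D).dist y y'')))
          = CN * ((cf ^ 2)⁻¹ * (pref cf y)⁻¹) * Real.exp (-(ρN * (geomT D).dist y y'')) := by ring
        _ = CN / (geomTB D).len y ^ 2 * Real.exp (-(ρN * (geomT D).dist y y'')) := by rw [inv_sq_mul_pref_inv cf hcf y]; ring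
        _ ≤ CNN / (geomTB D).len y ^ 2 * Real.exp (-((2 * σ) * (geomT D).dist y y'')) :=
            mul_le_mul (div_le_div_of_nonneg_right hCN1 (by positivity)) (exp_le_exp_of_rate (h2σ.trans hρN1) (hdnn y y''))
              (Real.exp_nonneg _) (by positivity))
    (fun c _ k _ => by
      have hx := outMajorant_mono (g := geomT D) _ (outMajorant_smul _ (hNout m K hN D hk hMh1 hP4 hMha hMh hR2 hℓ c (hpl c) w cf) ((cf ^ 2)⁻¹))
        (K' := fun (y y'' : (geomT D).Site) => CNN / (geomTB D).len y ^ 2 * Real.exp (-((2 * σ) * (geomT D).dist y y''))) fun y _ y'' => by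
          rw [habs2i]
          have hl := lenTB_pos (D := D) y
          calc (cf ^ 2)⁻¹ * (CN' * (pref cf y)⁻¹ * Real.exp (-(ρN' * (geomT D).dist y y'')))
              = CN' * ((cf ^ 2)⁻¹ * (pref cf y)⁻¹) * Real.exp (-(ρN' * (geomT D).dist y y'')) := by ring
            _ = CN' / (geomTB D).len y ^ 2 * Real.exp (-(ρN' * (geomT D).dist y y'')) := by rw [inv_sq_mul_pref_inv cf hcf y]; ring
            _ ≤ CNN / (geomTB D).len y ^ 2 * Real.exp (-((2 * σ) * (geomT D).dist y y'')) :=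
                mul_le_mul (div_le_div_of_nonneg_right hCN2 (by positivity)) (exp_le_exp_of_rate (h2σ.trans hρN2) (hdnn y y''))
                  (Real.exp_nonneg _) (by positivity)
      exact outMajorant_TB hN hx)
    -- hz
    (fun c _ k _ x => abs_zC_le hN hk hMh1 hP4 hMha c (band_le (d := d) (ℓ := ℓ) hb₀ hb₁) (hpl c) w cf x)
    -- hPlin, hPlout
    (fun c _ => by
      refine inMajorant_TB hN (inMajorant_mono (g := geomT D) _ (inMajorant_smul _ (hPlin m K hN D hk hMh1 hP4 hMha hMh hR2 hℓ c (hpl c) w cf) ((cf ^ 2)⁻¹))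
        (K' := fun (y y'' : (geomT D).Site) => CNN / (geomTB D).len y ^ 2 * Real.exp (-((2 * σ) * (geomT D).dist y y''))) fun y y'' _ => ?_)
      rw [habs2i]
      have hl := lenTB_pos (D := D) y
      calc (cf ^ 2)⁻¹ * (CP * (pref cf y)⁻¹ * Real.exp (-(ρP * (geomT D).dist y y'')))
          = CP * ((cf ^ 2)⁻¹ * (pref cf y)⁻¹) * Real.exp (-(ρP * (geomT D).dist y y'')) := by ring
        _ = CP / (geomTB D).len y ^ 2 * Real.exp (-(ρP * (geomT D).dist y y'')) := by rw [inv_sq_mul_pref_inv cf hcf y]; ring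
        _ ≤ CNN / (geomTB D).len y ^ 2 * Real.exp (-((2 * σ) * (geomT D).dist y y'')) :=
            mul_le_mul (div_le_div_of_nonneg_right hCP1 (by positivity)) (exp_le_exp_of_rate (h2σ.trans hρP1) (hdnn y y''))
              (Real.exp_nonneg _) (by positivity))
    (fun c _ => by
      have hx := outMajorant_mono (g := geomT D) _ (outMajorant_smul _ (hPlout m K hN D hk hMh1 hP4 hMha hMh hR2 hℓ c (hpl c) w cf) ((cf ^ 2)⁻¹))
        (K' := fun (y y'' : (geomT D).Site) => CNN / (geomTB D).len y ^ 2 * Real.exp (-((2 * σ) * (geomT D).dist y y''))) fun y _ y'' => by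
          rw [habs2i]
          have hl := lenTB_pos (D := D) y
          calc (cf ^ 2)⁻¹ * (CP' * (pref cf y)⁻¹ * Real.exp (-(ρP' * (geomT D).dist y y'')))
              = CP' * ((cf ^ 2)⁻¹ * (pref cf y)⁻¹) * Real.exp (-(ρP' * (geomT D).dist y y'')) := by ring
            _ = CP' / (geomTB D).len y ^ 2 * Real.exp (-(ρP' * (geomT D).dist y y'')) := by rw [inv_sq_mul_pref_inv cf hcf y]; ring
            _ ≤ CNN / (geomTB D).len y ^ 2 * Real.exp (-((2 * σ) * (geomT D).dist y y'')) :=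
                mul_le_mul (div_le_div_of_nonneg_right hCP2 (by positivity)) (exp_le_exp_of_rate (h2σ.trans hρP2) (hdnn y y''))
                  (Real.exp_nonneg _) (by positivity)
      exact outMajorant_TB hN hx)
    -- hζ0, hζ1, hζS
    (fun c _ x => zetaT_nonneg hMh1 hP4 c (toBox hN x.src)) (fun c _ x => zetaT_le_one hMh1 hP4 c (toBox hN x.src))
    (fun c _ x hx => not_mem_QbigT_of_zetaT_ne_one hMh1 hP4 c hx)
    -- hD3 (rescaled)
    (fun c _ => by
      have hx := hasMajorant_smul _ (hD3 c) ((cf ^ 2)⁻¹)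
      have eop : (cf ^ 2)⁻¹ • (mulOp (zB hN D hMh1 hP4 c) *
            (onFun (dE (P := PV d ℓ m K hd hL) cf ∘ₗ (LinearMap.id - RE (domT hN D hk) cf) ∘ₗ dsE cf) -
              Pl hN hk hMh1 hP4 hMha c (band_le (d := d) (ℓ := ℓ) hb₀ hb₁) (hpl c) w cf) * mulOp (hB hN D c)) =
          mulOp (zB hN D hMh1 hP4 c) *
            ((cf ^ 2)⁻¹ • onFun (dE (P := PV d ℓ m K hd hL) cf ∘ₗ (LinearMap.id - RE (domT hN D hk) cf) ∘ₗ dsE cf) -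
              (cf ^ 2)⁻¹ • Pl hN hk hMh1 hP4 hMha c (band_le (d := d) (ℓ := ℓ) hb₀ hb₁) (hpl c) w cf) * mulOp (hB hN D c) := by
        simp only [smul_sub, mul_sub, sub_mul, mul_smul_comm, smul_mul_assoc]
      rw [eop] at hx
      refine hasMajorant_mono _ hx fun y y'' => le_of_eq ?_
      rw [habs2i]
      have hl := lenTB_pos (D := D) y
      field_simp)
    -- hgap
    (fun c _ y y'' hy hy'' => gap_QT hℓ1 hMh hR hP5 c hy hy'')
  -- ### back to the TRUE family: `K(rescaled)·(c′²G_□) = K·G_□`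
  have e1 : σ * ((d : ℝ) + 1) / ((d : ℝ) + 1) = σ := by field_simp
  have e3 : (2 * (σ * ((d : ℝ) + 1) / ((d : ℝ) + 1))) / 2 = 2 * σ / 2 := by rw [e1]
  have hconv : ∀ {T : Module.End ℝ (PBond (PV d ℓ m K hd hL) 0 → ℝ)} {θ : ℝ},
      HasMajorant (g := geomTB D) (blkV1 hN D) T (fun (y y' : (geomT D).Site) => θ * Real.exp (-(2 * σ / 2 * (geomT D).dist y y'))) →
      HasMajorant (g := geomT D) (blkV1 hN D) T
        (fun y y' => θ * Real.exp (-((2 * (σ * ((d : ℝ) + 1) / ((d : ℝ) + 1))) / 2 * (geomT D).dist y y'))) :=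
    fun h => hasMajorant_T_of_TB hN (hasMajorant_mono (g := geomTB D) _ h fun y y' => le_of_eq (by rw [e3]))
  have h2134' := fun c c' => hconv (by
    have h := H c (Finset.mem_univ _) c' (Finset.mem_univ _)
    rw [kFam_smul, smul_mul_smul_comm, inv_mul_cancel₀ hcf2, one_smul] at h
    exact h)
  -- ### the two-family skeleton
  have hθ' : Real.exp (-(α * (σ * ((d : ℝ) + 1) / ((d : ℝ) + 1)))) * ((ℓ : ℝ) + 1) ^ ((2 * (d + 1 : ℕ) : ℝ) / N₀) < 1 := by
    rw [e1]; exact hθ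
  have h2133 : ∀ c : ↥(cubes D.toDomains), LocalMajorant (g := geomT D) (blkV1 hN D)
      (Gl hN hk hMh1 hP4 hMha c (band_le (d := d) (ℓ := ℓ) hb₀ hb₁) (hpl c) w cf) (ST D hMh1 hP4 c)
      (fun y y' => CG * pref cf y * Real.exp (-((2 * (σ * ((d : ℝ) + 1) / ((d : ℝ) + 1))) / 2 * (geomT D).dist y y'))) := by
    intro c
    refine (inMajorant_mono _ (hGin m K hN D hk hMh1 hP4 hMha hMh hR2 hℓ c (hpl c) w cf) fun y y' _ => ?_).localMajorant
    rw [e3]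
    have := pref_nonneg cf y
    exact mul_le_mul_of_nonneg_left (exp_le_exp_of_rate (by linarith) (hdnn y y')) (by positivity)
  have hsk := prop26_pair_kLevel_skeleton₂' hN D hk hMh hR hP5 (δ := σ * ((d : ℝ) + 1)) (A := CG) (by positivity) hCG α hα0 hα1 N₀ hN₀
    hRM hθ' hcf hw Nbig (hNov_SbigT_of_QbigT D hMh1 hP4 hNbig)
    (fun c => Gl hN hk hMh1 hP4 hMha c (band_le (d := d) (ℓ := ℓ) hb₀ hb₁) (hpl c) w cf)
    (fun c => Ml hN hk hMh1 hP4 hMha c (band_le (d := d) (ℓ := ℓ) hb₀ hb₁) (hpl c) w cf)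
    (fun c => Pl hN hk hMh1 hP4 hMha c (band_le (d := d) (ℓ := ℓ) hb₀ hb₁) (hpl c) w cf) h2133
    (fun c => hagree_cube hN hk hMh1 hP4 hMha c (band_le (d := d) (ℓ := ℓ) hb₀ hb₁) hk2 hM8 hR2 (hpl c) w hcf
      (fun i hi _ => band_of_global hN hk hMh1 hP4 c (le_of_lt hb₀) hcf w hwb i hi))
    (fun c => hinvl_cube hN hk hMh1 hP4 hMha c (band_le (d := d) (ℓ := ℓ) hb₀ hb₁) ha₀ hM8 hR2 (hpl c) w hcf) hMout _ ?hθ₀ h2134' ?hsm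
  case hθ₀ =>
    have hs := sLipT_nonneg d ℓ
    positivity
  case hsm =>
    rw [e1]
    have hs := sLipT_nonneg d ℓ
    exact small_of_small_two (by positivity) hsmall
  -- ### the final constants: `(1 − N²θ₀c₁)⁻¹ ≤ 2` (slot 1 and the left-factor clause)
  have hs := sLipT_nonneg d ℓ
  refine ⟨hasMajorant_mono _ hsk.1 fun y y' => ?_, fun Dop A' Pw hA' hPw hD => ?_⟩
  · rw [e1]
    exact final_const_le (Nat.cast_nonneg _) hCG hK0 (by positivity) (pref_nonneg cf y) (Real.exp_nonneg _) hsmall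
  · have e4 : (2 * (σ * ((d : ℝ) + 1) / ((d : ℝ) + 1))) / 2 = σ := by rw [e1]; ring
    have hD' : ∀ c : ↥(cubes D.toDomains), HasMajorant (g := geomT D) (blkV1 hN D)
        (Dop * (mulOp (hB hN D c) * Gl hN hk hMh1 hP4 hMha c (band_le (d := d) (ℓ := ℓ) hb₀ hb₁) (hpl c) w cf * mulOp (hB hN D c)))
        (fun y y' => ind (SbigT D hMh1 hP4 c) y *
          (A' * Pw y * Real.exp (-((2 * (σ * ((d : ℝ) + 1) / ((d : ℝ) + 1))) / 2 * (geomT D).dist y y')))) := fun c =>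
      hasMajorant_mono _ (hD c) fun y y' => le_of_eq (by rw [e4])
    refine hasMajorant_mono _ (hsk.2 Dop A' Pw hA' hPw hD') fun y y' => ?_
    rw [e1]
    exact final_const_le (Nat.cast_nonneg _) hA' hK0 (by positivity) (hPw y) (Real.exp_nonneg _) hsmall

end Assembly

end

end Literature.MathematicalPhysics.QuantumFieldTheory.Balaban1983to89.B6Prop26PairKLevelAssemblyV1
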